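import Mathlib
import HarnessLib
import Summits.KontsevichZagierPeriods.Zeta5Search.DougallComplexSlices

/-!
# ζ(5) search — Zudilin's (9) with all four parameters COMPLEX: the slot `h₀` (cell `pub-zeta5`, ct-1 g26)

HONEST FRAMING: systematic search; no irrationality claim unless kernel-certified.  An identity of special functions continued
analytically in its parameters; nothing here is an irrationality result; no named fact of the tree is discharged.

Brick B5g (last part) of `HOME/ct-1/g26/VWP-BLUEPRINT.md`: continuation of `DougallComplexSlices.zudilin_nine_complex` in the
remaining slot `v = h₀` on the half-strip `{Re v > max(0, Re(h₁+h₂+h₃) − 1)}`.  The parameter `h₀` sits in four places, so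
the majorant is not a four-Gamma term at one real point; it is a product of Gamma ratios bounded by
`DougallCoefficientBounds.Gamma_ratio_le`:
* `summable_gammaRatios` — `Σ_μ (R+2μ)Γ(a₀+μ)Γ(a₁+μ)Γ(a₂+μ)Γ(a₃+μ)/(Γ(μ+1)Γ(b₁+μ)Γ(b₂+μ)Γ(b₃+μ)) < ∞` when
  `a₀ + Σ(aⱼ−bⱼ) < −1` (all parameters positive);
* `differentiableOn_series_h0`, `differentiableOn_gammaSide_h0` — holomorphy of both sides of (9) in `h₀`;
* `zudilin_nine_complex'` — (9) for complex `h₀, h₁, h₂, h₃` with `Re hⱼ > 0` and `Re(h₁+h₂+h₃) < 1 + Re h₀`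
  [cite: Bailey1935, §4.4 (1)] — the form Zudilin's induction (13)–(14) consumes (blueprint B6).
Theorems only (no new definitions).
-/

noncomputable section

namespace Summit.KontsevichZagierPeriods.Zeta5Search.DougallComplexH0

open Finset Filter Set Metric
open Summit.KontsevichZagierPeriods.Zeta5Search.HypergeometricWhipple (rf rf_zero rf_succ)
open Summit.KontsevichZagierPeriods.Zeta5Search.DougallCoefficientBounds (Gamma_add_nat_eq Gamma_ratio_le)
open Summit.KontsevichZagierPeriods.Zeta5Search.DougallParameterHolomorphy (prod_re_le_norm_rf norm_Gamma_add_nat_le)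
open Summit.KontsevichZagierPeriods.Zeta5Search.DougallComplexParameters (norm_inv_Gamma_add_nat_le)
open Summit.KontsevichZagierPeriods.Zeta5Search.DougallComplexSlices (zudilin_nine_complex)
open Summit.KontsevichZagierPeriods.Zeta5Search.BarnesMellin (ne_neg_nat_of_re_pos)
open Literature.NumberTheory.LFunctions (norm_Gamma_le_Gamma_re)

/-! ### 1. A summable product of Gamma ratios -/

/-- **Summability of a product of Gamma ratios**: for positive `a₀,…,a₃, b₁, b₂, b₃`, `R ≥ 0` and
`a₀ + (a₁−b₁) + (a₂−b₂) + (a₃−b₃) < −1`,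
`Σ_μ (R+2μ)·Γ(a₀+μ)Γ(a₁+μ)Γ(a₂+μ)Γ(a₃+μ)/(Γ(μ+1)Γ(b₁+μ)Γ(b₂+μ)Γ(b₃+μ)) < ∞` (the term is `O(μ^{a₀+Σ(aⱼ−bⱼ)})`). -/
theorem summable_gammaRatios (R a₀ a₁ a₂ a₃ b₁ b₂ b₃ : ℝ) (hR : 0 ≤ R) (ha₀ : 0 < a₀) (ha₁ : 0 < a₁) (ha₂ : 0 < a₂)
    (ha₃ : 0 < a₃) (hb₁ : 0 < b₁) (hb₂ : 0 < b₂) (hb₃ : 0 < b₃)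
    (hexp : a₀ + (a₁ - b₁) + (a₂ - b₂) + (a₃ - b₃) < -1) :
    Summable fun μ : ℕ => (R + 2 * μ) *
      (Real.Gamma (a₀ + μ) * Real.Gamma (a₁ + μ) * Real.Gamma (a₂ + μ) * Real.Gamma (a₃ + μ)) /
      (Real.Gamma ((μ : ℝ) + 1) * Real.Gamma (b₁ + μ) * Real.Gamma (b₂ + μ) * Real.Gamma (b₃ + μ)) := by
  set K : ℝ := 3 * 2 ^ (1 + a₀) * 2 ^ (1 + a₁) * 2 ^ (1 + a₂) * 2 ^ (1 + a₃) with hK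
  set p : ℝ := 1 + (a₀ - 1) + (a₁ - b₁) + (a₂ - b₂) + (a₃ - b₃) with hp
  have hp1 : p < -1 := by rw [hp]; linarith
  have hg : Summable fun μ : ℕ => K * (μ : ℝ) ^ p := (Real.summable_nat_rpow.2 hp1).mul_left K
  refine Summable.of_norm_bounded_eventually_nat hg ?_
  rw [Filter.eventually_atTop]
  refine ⟨⌈1 + R + a₀ + a₁ + a₂ + a₃⌉₊, fun μ hμ => ?_⟩
  have hμ0 : 1 + R + a₀ + a₁ + a₂ + a₃ ≤ (μ : ℝ) := le_trans (Nat.le_ceil _) (by exact_mod_cast hμ)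
  set x : ℝ := (μ : ℝ) with hx
  have hx1 : 1 ≤ x := by linarith
  have hx0 : 0 < x := by linarith
  have G0 := Real.Gamma_pos_of_pos (show 0 < a₀ + x by positivity)
  have G1 := Real.Gamma_pos_of_pos (show 0 < a₁ + x by positivity)
  have G2 := Real.Gamma_pos_of_pos (show 0 < a₂ + x by positivity)
  have G3 := Real.Gamma_pos_of_pos (show 0 < a₃ + x by positivity)
  have Gf := Real.Gamma_pos_of_pos (show 0 < x + 1 by positivity)
  have Gb1 := Real.Gamma_pos_of_pos (show 0 < b₁ + x by positivity)
  have Gb2 := Real.Gamma_pos_of_pos (show 0 < b₂ + x by positivity)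
  have Gb3 := Real.Gamma_pos_of_pos (show 0 < b₃ + x by positivity)
  have hnn : 0 ≤ (R + 2 * x) *
      (Real.Gamma (a₀ + x) * Real.Gamma (a₁ + x) * Real.Gamma (a₂ + x) * Real.Gamma (a₃ + x)) /
      (Real.Gamma (x + 1) * Real.Gamma (b₁ + x) * Real.Gamma (b₂ + x) * Real.Gamma (b₃ + x)) := by positivity
  rw [Real.norm_of_nonneg hnn]
  have e : (R + 2 * x) *
      (Real.Gamma (a₀ + x) * Real.Gamma (a₁ + x) * Real.Gamma (a₂ + x) * Real.Gamma (a₃ + x)) /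
      (Real.Gamma (x + 1) * Real.Gamma (b₁ + x) * Real.Gamma (b₂ + x) * Real.Gamma (b₃ + x)) =
      (R + 2 * x) * (Real.Gamma (x + a₀) / Real.Gamma (x + 1)) * (Real.Gamma (x + a₁) / Real.Gamma (x + b₁)) *
        (Real.Gamma (x + a₂) / Real.Gamma (x + b₂)) * (Real.Gamma (x + a₃) / Real.Gamma (x + b₃)) := by
    rw [add_comm a₀ x, add_comm a₁ x, add_comm a₂ x, add_comm a₃ x, add_comm b₁ x, add_comm b₂ x, add_comm b₃ x]
    field_simp
  rw [e]
  have r0 := Gamma_ratio_le (a := a₀) (b := 1) hx1 (by linarith) ha₀.le zero_le_one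
  have r1 := Gamma_ratio_le (a := a₁) (b := b₁) hx1 (by linarith) ha₁.le hb₁.le
  have r2 := Gamma_ratio_le (a := a₂) (b := b₂) hx1 (by linarith) ha₂.le hb₂.le
  have r3 := Gamma_ratio_le (a := a₃) (b := b₃) hx1 (by linarith) ha₃.le hb₃.le
  have hlin : R + 2 * x ≤ 3 * x ^ (1 : ℝ) := by rw [Real.rpow_one]; linarith
  rw [add_comm x a₀, add_comm x a₁, add_comm x a₂, add_comm x a₃, add_comm x b₁, add_comm x b₂, add_comm x b₃] at *
  have hE : (3 * x ^ (1 : ℝ)) * (2 ^ (1 + a₀) * x ^ (a₀ - 1)) * (2 ^ (1 + a₁) * x ^ (a₁ - b₁)) *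
      (2 ^ (1 + a₂) * x ^ (a₂ - b₂)) * (2 ^ (1 + a₃) * x ^ (a₃ - b₃)) = K * x ^ p := by
    have : x ^ (1 : ℝ) * x ^ (a₀ - 1) * x ^ (a₁ - b₁) * x ^ (a₂ - b₂) * x ^ (a₃ - b₃) = x ^ p := by
      rw [← Real.rpow_add hx0, ← Real.rpow_add hx0, ← Real.rpow_add hx0, ← Real.rpow_add hx0]
    rw [hK, ← this]; ring
  rw [← hE]
  have P0 : 0 ≤ Real.Gamma (a₀ + x) / Real.Gamma (x + 1) := by positivity
  have P1 : 0 ≤ Real.Gamma (a₁ + x) / Real.Gamma (b₁ + x) := by positivity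
  have P2 : 0 ≤ Real.Gamma (a₂ + x) / Real.Gamma (b₂ + x) := by positivity
  have P3 : 0 ≤ Real.Gamma (a₃ + x) / Real.Gamma (b₃ + x) := by positivity
  have h3x : 0 ≤ 3 * x ^ (1 : ℝ) := by positivity
  exact mul_le_mul (mul_le_mul (mul_le_mul (mul_le_mul hlin r0 P0 h3x) r1 P1 (by positivity)) r2 P2
    (by positivity)) r3 P3 (by positivity)

/-! ### 2. Holomorphy of both sides of (9) in the slot `v = h₀` -/

/-- Each term of (9) is holomorphic in `v = h₀` where `Re v > Re hⱼ − 1` (`j = 1, 2, 3`) and `Re v > 0`. -/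
theorem differentiableAt_term_h0 (h₁ h₂ h₃ : ℂ) (μ : ℕ) {v : ℂ} (hv : 0 < v.re) (hv₁ : h₁.re - 1 < v.re)
    (hv₂ : h₂.re - 1 < v.re) (hv₃ : h₃.re - 1 < v.re) :
    DifferentiableAt ℂ (fun v : ℂ => (v + 2 * μ) *
        (Complex.Gamma (v + μ) * Complex.Gamma (h₁ + μ) * Complex.Gamma (h₂ + μ) * Complex.Gamma (h₃ + μ)) /
        (Complex.Gamma ((μ : ℂ) + 1) * Complex.Gamma (v - h₁ + 1 + μ) * Complex.Gamma (v - h₂ + 1 + μ) *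
          Complex.Gamma (v - h₃ + 1 + μ))) v := by
  have d0 : DifferentiableAt ℂ (fun v : ℂ => Complex.Gamma (v + μ)) v :=
    (Complex.differentiableAt_Gamma _ (ne_neg_nat_of_re_pos (by simp; positivity))).comp v
      (differentiableAt_id.add_const _)
  have dj : ∀ {h : ℂ}, h.re - 1 < v.re → DifferentiableAt ℂ (fun v : ℂ => Complex.Gamma (v - h + 1 + μ)) v := by
    intro h hh
    exact (Complex.differentiableAt_Gamma _ (ne_neg_nat_of_re_pos (by simp; linarith [μ.cast_nonneg (α := ℝ)]))).comp v
      (((differentiableAt_id.sub_const _).add_const _).add_const _)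
  refine DifferentiableAt.div ?_ ?_ ?_
  · exact (differentiableAt_id.add_const _).mul (((d0.mul_const _).mul_const _).mul_const _)
  · exact (((differentiableAt_const _).mul (dj hv₁)).mul (dj hv₂)).mul (dj hv₃)
  · have g0 : Complex.Gamma ((μ : ℂ) + 1) ≠ 0 := Complex.Gamma_ne_zero (ne_neg_nat_of_re_pos (by simp; positivity))
    have gj : ∀ {h : ℂ}, h.re - 1 < v.re → Complex.Gamma (v - h + 1 + μ) ≠ 0 := fun hh =>
      Complex.Gamma_ne_zero (ne_neg_nat_of_re_pos (by simp; linarith [μ.cast_nonneg (α := ℝ)]))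
    exact mul_ne_zero (mul_ne_zero (mul_ne_zero g0 (gj hv₁)) (gj hv₂)) (gj hv₃)

/-- **Holomorphy of the series of (9) in `v = h₀`** (complex `h₁, h₂, h₃` with positive real parts) on
`E = {Re(h₁+h₂+h₃) − 1 < Re v, 0 < Re v}`: Weierstrass M-test on small balls against `summable_gammaRatios`. -/
theorem differentiableOn_series_h0 (h₁ h₂ h₃ : ℂ) (hx₁ : 0 < h₁.re) (hx₂ : 0 < h₂.re) (hx₃ : 0 < h₃.re) :
    DifferentiableOn ℂ (fun v : ℂ => ∑' μ : ℕ, (v + 2 * μ) *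
        (Complex.Gamma (v + μ) * Complex.Gamma (h₁ + μ) * Complex.Gamma (h₂ + μ) * Complex.Gamma (h₃ + μ)) /
        (Complex.Gamma ((μ : ℂ) + 1) * Complex.Gamma (v - h₁ + 1 + μ) * Complex.Gamma (v - h₂ + 1 + μ) *
          Complex.Gamma (v - h₃ + 1 + μ)))
      {v : ℂ | h₁.re + h₂.re + h₃.re - 1 < v.re ∧ 0 < v.re} := by
  intro v₀ hv₀
  obtain ⟨hs₀, hp₀⟩ := hv₀
  set g : ℝ := 1 + v₀.re - (h₁.re + h₂.re + h₃.re) with hg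
  have hgpos : 0 < g := by rw [hg]; linarith
  set δ : ℝ := min (v₀.re / 2) (g / 4) with hδ
  have hδpos : 0 < δ := lt_min (by linarith) (by linarith)
  have hδ1 : δ ≤ v₀.re / 2 := min_le_left _ _
  have hδ2 : δ ≤ g / 4 := min_le_right _ _
  set xl : ℝ := v₀.re - δ with hxl
  set xu : ℝ := v₀.re + δ with hxu
  have hxl0 : 0 < xl := by rw [hxl]; linarith
  have hb₁ : 0 < xl - h₁.re + 1 := by rw [hxl]; linarith
  have hb₂ : 0 < xl - h₂.re + 1 := by rw [hxl]; linarith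
  have hb₃ : 0 < xl - h₃.re + 1 := by rw [hxl]; linarith
  have hexp : xu + (h₁.re - (xl - h₁.re + 1)) + (h₂.re - (xl - h₂.re + 1)) + (h₃.re - (xl - h₃.re + 1)) < -1 := by
    rw [hxu, hxl]; linarith
  have hre : ∀ v ∈ ball v₀ δ, xl < v.re ∧ v.re < xu := by
    intro v hv
    rw [mem_ball, dist_eq_norm] at hv
    have h1 := Complex.abs_re_le_norm (v - v₀)
    simp only [Complex.sub_re] at h1
    have h2 := abs_lt.1 (lt_of_le_of_lt h1 hv)
    constructor
    · rw [hxl]; linarith [h2.1]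
    · rw [hxu]; linarith [h2.2]
  set R : ℝ := ‖v₀‖ + δ with hR
  have hRnn : 0 ≤ R := by positivity
  have hnorm : ∀ v ∈ ball v₀ δ, ‖v‖ ≤ R := by
    intro v hv
    rw [mem_ball, dist_eq_norm] at hv
    have := norm_le_norm_add_norm_sub' v v₀  -- ‖v‖ ≤ ‖v₀‖ + ‖v - v₀‖
    rw [hR]; linarith
  obtain ⟨MΓ, hMΓ⟩ : ∃ M : ℝ, ∀ x ∈ Icc xl xu, Real.Gamma x ≤ M := by
    have hc : ContinuousOn Real.Gamma (Icc xl xu) := fun x hx =>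
      (Real.differentiableAt_Gamma fun m => by
        have : 0 < x := lt_of_lt_of_le hxl0 hx.1
        intro h; rw [h] at this
        have := m.cast_nonneg (α := ℝ); linarith).continuousAt.continuousWithinAt
    obtain ⟨M, hM⟩ := isCompact_Icc.exists_bound_of_continuousOn hc
    exact ⟨M, fun x hx => (le_abs_self _).trans (by simpa [Real.norm_eq_abs] using hM x hx)⟩
  have hMΓ0 : 0 ≤ MΓ :=
    (Real.Gamma_pos_of_pos hp₀).le.trans (hMΓ v₀.re ⟨by rw [hxl]; linarith, by rw [hxu]; linarith⟩)
  -- bounds `Mⱼ` for `‖Γ(v−hⱼ+1)⁻¹‖` on the closed ball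
  have hMj : ∀ h : ℂ, ∃ M : ℝ, 0 ≤ M ∧ ∀ v ∈ closedBall v₀ δ, ‖(Complex.Gamma (v - h + 1))⁻¹‖ ≤ M := by
    intro h
    have hd : Differentiable ℂ fun v : ℂ => v - h + 1 := by fun_prop
    have hc : Continuous fun v : ℂ => (Complex.Gamma (v - h + 1))⁻¹ :=
      (Complex.differentiable_one_div_Gamma.comp hd).continuous
    obtain ⟨M, hM⟩ := (isCompact_closedBall v₀ δ).exists_bound_of_continuousOn hc.continuousOn
    exact ⟨M, (norm_nonneg _).trans (hM v₀ (mem_closedBall_self hδpos.le)), hM⟩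
  obtain ⟨M₁, hM₁0, hM₁⟩ := hMj h₁
  obtain ⟨M₂, hM₂0, hM₂⟩ := hMj h₂
  obtain ⟨M₃, hM₃0, hM₃⟩ := hMj h₃
  -- the majorant
  set u : ℕ → ℝ := fun μ => ((R + 2 * μ) * ((MΓ * ∏ i ∈ range μ, (xu + i)) * Real.Gamma (h₁.re + μ) *
      Real.Gamma (h₂.re + μ) * Real.Gamma (h₃.re + μ))) *
    ((Real.Gamma ((μ : ℝ) + 1))⁻¹ * (M₁ / ∏ i ∈ range μ, (xl - h₁.re + 1 + i)) *
      (M₂ / ∏ i ∈ range μ, (xl - h₂.re + 1 + i)) * (M₃ / ∏ i ∈ range μ, (xl - h₃.re + 1 + i))) with hu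
  have hsum : Summable u := by
    have h4 := (summable_gammaRatios R xu h₁.re h₂.re h₃.re (xl - h₁.re + 1) (xl - h₂.re + 1) (xl - h₃.re + 1)
      hRnn (by linarith) hx₁ hx₂ hx₃ hb₁ hb₂ hb₃ hexp).mul_left
      (MΓ * M₁ * M₂ * M₃ * Real.Gamma (xl - h₁.re + 1) * Real.Gamma (xl - h₂.re + 1) * Real.Gamma (xl - h₃.re + 1) /
        Real.Gamma xu)
    refine h4.congr fun μ => ?_
    have hΓxu : Real.Gamma xu ≠ 0 := (Real.Gamma_pos_of_pos (by linarith)).ne'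
    have hΓ1 : Real.Gamma (xl - h₁.re + 1) ≠ 0 := (Real.Gamma_pos_of_pos hb₁).ne'
    have hΓ2 : Real.Gamma (xl - h₂.re + 1) ≠ 0 := (Real.Gamma_pos_of_pos hb₂).ne'
    have hΓ3 : Real.Gamma (xl - h₃.re + 1) ≠ 0 := (Real.Gamma_pos_of_pos hb₃).ne'
    have hΓμ : Real.Gamma ((μ : ℝ) + 1) ≠ 0 := (Real.Gamma_pos_of_pos (by positivity)).ne'
    have P1 : ∏ i ∈ range μ, (xl - h₁.re + 1 + i) ≠ 0 :=
      (Finset.prod_pos fun i _ => by linarith [i.cast_nonneg (α := ℝ)]).ne'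
    have P2 : ∏ i ∈ range μ, (xl - h₂.re + 1 + i) ≠ 0 :=
      (Finset.prod_pos fun i _ => by linarith [i.cast_nonneg (α := ℝ)]).ne'
    have P3 : ∏ i ∈ range μ, (xl - h₃.re + 1 + i) ≠ 0 :=
      (Finset.prod_pos fun i _ => by linarith [i.cast_nonneg (α := ℝ)]).ne'
    rw [hu]
    simp only
    rw [Gamma_add_nat_eq xu (by linarith) μ, Gamma_add_nat_eq (xl - h₁.re + 1) hb₁ μ,
      Gamma_add_nat_eq (xl - h₂.re + 1) hb₂ μ, Gamma_add_nat_eq (xl - h₃.re + 1) hb₃ μ]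
    field_simp
  have hdiff : DifferentiableOn ℂ (fun v : ℂ => ∑' μ : ℕ, (v + 2 * μ) *
        (Complex.Gamma (v + μ) * Complex.Gamma (h₁ + μ) * Complex.Gamma (h₂ + μ) * Complex.Gamma (h₃ + μ)) /
        (Complex.Gamma ((μ : ℂ) + 1) * Complex.Gamma (v - h₁ + 1 + μ) * Complex.Gamma (v - h₂ + 1 + μ) *
          Complex.Gamma (v - h₃ + 1 + μ))) (ball v₀ δ) := by
    refine Complex.differentiableOn_tsum_of_summable_norm hsum (fun μ v hv => ?_) isOpen_ball (fun μ v hv => ?_)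
    · obtain ⟨h1, h2⟩ := hre v hv
      exact (differentiableAt_term_h0 h₁ h₂ h₃ μ (by linarith) (by linarith) (by linarith)
        (by linarith)).differentiableWithinAt
    · obtain ⟨h1, h2⟩ := hre v hv
      have hvpos : 0 < v.re := by linarith
      -- numerator and denominator
      have nv : ‖v + 2 * μ‖ ≤ R + 2 * μ := by
        calc ‖v + 2 * μ‖ ≤ ‖v‖ + ‖(2 * μ : ℂ)‖ := norm_add_le _ _
          _ = ‖v‖ + 2 * μ := by
              rw [show (2 * μ : ℂ) = ((2 * μ : ℝ) : ℂ) by push_cast; ring, Complex.norm_real,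
                Real.norm_of_nonneg (by positivity)]
          _ ≤ R + 2 * μ := by linarith [hnorm v hv]
      have n0 : ‖Complex.Gamma (v + μ)‖ ≤ MΓ * ∏ i ∈ range μ, (xu + i) := by
        refine (norm_Gamma_add_nat_le hvpos μ).trans ?_
        exact mul_le_mul (hMΓ v.re ⟨h1.le, h2.le⟩) (Finset.prod_le_prod (fun i _ => by positivity)
          fun i _ => by linarith) (Finset.prod_nonneg fun i _ => by positivity) hMΓ0
      have nj : ∀ {h : ℂ}, 0 < h.re → ‖Complex.Gamma (h + μ)‖ ≤ Real.Gamma (h.re + μ) := by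
        intro h hh
        simpa using norm_Gamma_le_Gamma_re (s := h + μ) (by simp; positivity)
      have hN : ‖(v + 2 * μ) *
          (Complex.Gamma (v + μ) * Complex.Gamma (h₁ + μ) * Complex.Gamma (h₂ + μ) * Complex.Gamma (h₃ + μ))‖ ≤
          (R + 2 * μ) * ((MΓ * ∏ i ∈ range μ, (xu + i)) * Real.Gamma (h₁.re + μ) *
            Real.Gamma (h₂.re + μ) * Real.Gamma (h₃.re + μ)) := by
        rw [norm_mul, norm_mul, norm_mul, norm_mul]
        have G1 := Real.Gamma_pos_of_pos (show 0 < h₁.re + μ by positivity)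
        have G2 := Real.Gamma_pos_of_pos (show 0 < h₂.re + μ by positivity)
        have hP : 0 ≤ MΓ * ∏ i ∈ range μ, (xu + i) := mul_nonneg hMΓ0 (Finset.prod_nonneg fun i _ => by positivity)
        refine mul_le_mul nv ?_ (by positivity) (by positivity)
        exact mul_le_mul (mul_le_mul (mul_le_mul n0 (nj hx₁) (norm_nonneg _) hP) (nj hx₂) (norm_nonneg _)
          (by positivity)) (nj hx₃) (norm_nonneg _) (by positivity)
      have dμ : ‖(Complex.Gamma ((μ : ℂ) + 1))⁻¹‖ = (Real.Gamma ((μ : ℝ) + 1))⁻¹ := by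
        rw [norm_inv, Complex.Gamma_nat_eq_factorial, Real.Gamma_nat_eq_factorial, Complex.norm_natCast]
      have dj : ∀ {h : ℂ} {M : ℝ}, 0 ≤ M → (∀ v ∈ closedBall v₀ δ, ‖(Complex.Gamma (v - h + 1))⁻¹‖ ≤ M) →
          0 < xl - h.re + 1 →
          ‖(Complex.Gamma (v - h + 1 + μ))⁻¹‖ ≤ M / ∏ i ∈ range μ, (xl - h.re + 1 + i) := by
        intro h M hM0 hM hb
        have hζ : 0 < (v - h + 1).re := by simp; linarith
        refine (norm_inv_Gamma_add_nat_le hζ μ).trans ?_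
        simp only [Complex.add_re, Complex.sub_re, Complex.one_re]
        exact div_le_div₀ hM0 (hM v (ball_subset_closedBall hv))
          (Finset.prod_pos fun i _ => by linarith [i.cast_nonneg (α := ℝ)])
          (Finset.prod_le_prod (fun i _ => by linarith [i.cast_nonneg (α := ℝ)]) fun i _ => by linarith)
      have b1 := dj hM₁0 hM₁ hb₁
      have b2 := dj hM₂0 hM₂ hb₂
      have b3 := dj hM₃0 hM₃ hb₃
      have Q1 : 0 ≤ M₁ / ∏ i ∈ range μ, (xl - h₁.re + 1 + i) :=
        div_nonneg hM₁0 (Finset.prod_nonneg fun i _ => by linarith [i.cast_nonneg (α := ℝ)])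
      have Q2 : 0 ≤ M₂ / ∏ i ∈ range μ, (xl - h₂.re + 1 + i) :=
        div_nonneg hM₂0 (Finset.prod_nonneg fun i _ => by linarith [i.cast_nonneg (α := ℝ)])
      have hD : ‖(Complex.Gamma ((μ : ℂ) + 1) * Complex.Gamma (v - h₁ + 1 + μ) * Complex.Gamma (v - h₂ + 1 + μ) *
          Complex.Gamma (v - h₃ + 1 + μ))⁻¹‖ ≤
          (Real.Gamma ((μ : ℝ) + 1))⁻¹ * (M₁ / ∏ i ∈ range μ, (xl - h₁.re + 1 + i)) *
            (M₂ / ∏ i ∈ range μ, (xl - h₂.re + 1 + i)) * (M₃ / ∏ i ∈ range μ, (xl - h₃.re + 1 + i)) := by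
        rw [mul_inv, mul_inv, mul_inv, norm_mul, norm_mul, norm_mul, dμ]
        have G0 : 0 ≤ (Real.Gamma ((μ : ℝ) + 1))⁻¹ := (inv_pos.2 (Real.Gamma_pos_of_pos (by positivity))).le
        exact mul_le_mul (mul_le_mul (mul_le_mul_of_nonneg_left b1 G0) b2 (norm_nonneg _) (mul_nonneg G0 Q1)) b3
          (norm_nonneg _) (mul_nonneg (mul_nonneg G0 Q1) Q2)
      rw [div_eq_mul_inv, norm_mul, hu]
      exact mul_le_mul hN hD (norm_nonneg _) (by positivity)
  exact (hdiff.differentiableAt (isOpen_ball.mem_nhds (mem_ball_self hδpos))).differentiableWithinAt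

/-- The Gamma side of (9) is holomorphic in `v = h₀` on `E` (complex `h₁, h₂, h₃` with positive real parts). -/
theorem differentiableOn_gammaSide_h0 (h₁ h₂ h₃ : ℂ) (hx₁ : 0 < h₁.re) (hx₂ : 0 < h₂.re) (hx₃ : 0 < h₃.re) :
    DifferentiableOn ℂ (fun v : ℂ => Complex.Gamma h₁ * Complex.Gamma h₂ * Complex.Gamma h₃ *
        Complex.Gamma (v - h₁ - h₂ - h₃ + 1) /
        (Complex.Gamma (v - h₁ - h₂ + 1) * Complex.Gamma (v - h₁ - h₃ + 1) * Complex.Gamma (v - h₂ - h₃ + 1)))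
      {v : ℂ | h₁.re + h₂.re + h₃.re - 1 < v.re ∧ 0 < v.re} := by
  intro v hv
  obtain ⟨hv, hv'⟩ := hv
  have dN : DifferentiableAt ℂ (fun v : ℂ => Complex.Gamma (v - h₁ - h₂ - h₃ + 1)) v :=
    (Complex.differentiableAt_Gamma _ (ne_neg_nat_of_re_pos (by simp; linarith))).comp v
      ((((differentiableAt_id.sub_const _).sub_const _).sub_const _).add_const _)
  have dD : ∀ {a b : ℂ}, a.re + b.re - 1 < v.re →
      DifferentiableAt ℂ (fun v : ℂ => Complex.Gamma (v - a - b + 1)) v ∧ Complex.Gamma (v - a - b + 1) ≠ 0 := by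
    intro a b hab
    have hre : 0 < (v - a - b + 1).re := by simp; linarith
    exact ⟨(Complex.differentiableAt_Gamma _ (ne_neg_nat_of_re_pos hre)).comp v
      (((differentiableAt_id.sub_const _).sub_const _).add_const _), Complex.Gamma_ne_zero (ne_neg_nat_of_re_pos hre)⟩
  obtain ⟨d12, g12⟩ := dD (a := h₁) (b := h₂) (by linarith)
  obtain ⟨d13, g13⟩ := dD (a := h₁) (b := h₃) (by linarith)
  obtain ⟨d23, g23⟩ := dD (a := h₂) (b := h₃) (by linarith)
  exact (DifferentiableAt.div ((differentiableAt_const _).mul dN) ((d12.mul d13).mul d23)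
    (mul_ne_zero (mul_ne_zero g12 g13) g23)).differentiableWithinAt

/-! ### 3. All four parameters complex -/

/-- **Zudilin's (9) = Dougall's `₅F₄` sum in Gamma form for COMPLEX parameters**: for `h₀, h₁, h₂, h₃ ∈ ℂ` with
`Re hⱼ > 0` (`j = 0,…,3`) and `Re h₁ + Re h₂ + Re h₃ < 1 + Re h₀`,
`Σ_μ (h₀+2μ)Γ(h₀+μ)Γ(h₁+μ)Γ(h₂+μ)Γ(h₃+μ)/(Γ(μ+1)Γ(h₀−h₁+1+μ)Γ(h₀−h₂+1+μ)Γ(h₀−h₃+1+μ))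
 = Γ(h₁)Γ(h₂)Γ(h₃)Γ(h₀−h₁−h₂−h₃+1)/(Γ(h₀−h₁−h₂+1)Γ(h₀−h₁−h₃+1)Γ(h₀−h₂−h₃+1))` — the slice in `h₀` of
`DougallComplexSlices.zudilin_nine_complex` (identity theorem from the real points of the half-strip
`{Re v > max(0, Re(h₁+h₂+h₃) − 1)}`). [cite: Bailey1935, §4.4 (1)] -/
theorem zudilin_nine_complex' (h₀ h₁ h₂ h₃ : ℂ) (hx₀ : 0 < h₀.re) (hx₁ : 0 < h₁.re) (hx₂ : 0 < h₂.re)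
    (hx₃ : 0 < h₃.re) (hs : h₁.re + h₂.re + h₃.re < 1 + h₀.re) :
    ∑' μ : ℕ, (h₀ + 2 * μ) *
        (Complex.Gamma (h₀ + μ) * Complex.Gamma (h₁ + μ) * Complex.Gamma (h₂ + μ) * Complex.Gamma (h₃ + μ)) /
        (Complex.Gamma ((μ : ℂ) + 1) * Complex.Gamma (h₀ - h₁ + 1 + μ) * Complex.Gamma (h₀ - h₂ + 1 + μ) *
          Complex.Gamma (h₀ - h₃ + 1 + μ)) =
      Complex.Gamma h₁ * Complex.Gamma h₂ * Complex.Gamma h₃ * Complex.Gamma (h₀ - h₁ - h₂ - h₃ + 1) /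
        (Complex.Gamma (h₀ - h₁ - h₂ + 1) * Complex.Gamma (h₀ - h₁ - h₃ + 1) * Complex.Gamma (h₀ - h₂ - h₃ + 1)) := by
  set S : ℂ → ℂ := fun v : ℂ => ∑' μ : ℕ, (v + 2 * μ) *
        (Complex.Gamma (v + μ) * Complex.Gamma (h₁ + μ) * Complex.Gamma (h₂ + μ) * Complex.Gamma (h₃ + μ)) /
        (Complex.Gamma ((μ : ℂ) + 1) * Complex.Gamma (v - h₁ + 1 + μ) * Complex.Gamma (v - h₂ + 1 + μ) *
          Complex.Gamma (v - h₃ + 1 + μ)) with hS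
  set G : ℂ → ℂ := fun v : ℂ => Complex.Gamma h₁ * Complex.Gamma h₂ * Complex.Gamma h₃ *
        Complex.Gamma (v - h₁ - h₂ - h₃ + 1) /
        (Complex.Gamma (v - h₁ - h₂ + 1) * Complex.Gamma (v - h₁ - h₃ + 1) * Complex.Gamma (v - h₂ - h₃ + 1)) with hG
  set E : Set ℂ := {v : ℂ | h₁.re + h₂.re + h₃.re - 1 < v.re ∧ 0 < v.re} with hE
  have hSE : DifferentiableOn ℂ S E := differentiableOn_series_h0 h₁ h₂ h₃ hx₁ hx₂ hx₃
  have hGE : DifferentiableOn ℂ G E := differentiableOn_gammaSide_h0 h₁ h₂ h₃ hx₁ hx₂ hx₃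
  have hEo : IsOpen E :=
    (isOpen_lt continuous_const Complex.continuous_re).inter (isOpen_lt continuous_const Complex.continuous_re)
  have hEc : IsPreconnected E := ((convex_halfSpace_re_gt _).inter (convex_halfSpace_re_gt 0)).isPreconnected
  have hx : (((h₁.re + h₂.re + h₃.re + 1 : ℝ)) : ℂ) ∈ E := ⟨by simp; linarith, by simp; linarith⟩
  have hEq : EqOn S G E := by
    refine Literature.Analysis.Complex.eqOn_of_isPreconnected_of_eq_ofReal hEo hEc hx hSE hGE fun t ht => ?_
    obtain ⟨ht0, ht1⟩ := ht
    simp only [Complex.ofReal_re] at ht0 ht1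
    exact zudilin_nine_complex t h₁ h₂ h₃ ht1 hx₁ hx₂ hx₃ (by linarith)
  exact hEq (show h₀ ∈ E from ⟨by linarith, hx₀⟩)

end Summit.KontsevichZagierPeriods.Zeta5Search.DougallComplexH0

end
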